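import Summits.QuantumFields.YangMills.Theorems.VirialFluxGapResolventFieldPointwise
import HarnessLib

/-!
# Route `VirialFluxGap` (YangMills): KERNEL VECTORS OF THE FRAME HESSIAN FROM VALLEY CURVES (toward input (iii) of the resolvent Euler
# field's generic-region estimates)

Toward the deciding crux `VirialFluxGap.PeriodicSoftness` (item stmt-QuantumFields-24141), generic-region Euler field (memo
`fcl-p3-g40-RESOLVENT-EULER-FIELD-24141.md`).  ✓`FrameHessian.generic_divergence_upper` needs an orthonormal family of KERNEL vectors of the raw
frame Hessian `Ĥ(p)` at a zero `p` of `F₀` (`m = 6` on the tree-gauged space, `3L³ + 3` on `Ω_L`).  This file proves the abstract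
mechanism producing them from curves INSIDE the zero set, with no differentiation of the exponential map:

* §1 `quadForm_eq_zero_imp_mulVec_eq_zero` — for a symmetric positive-semidefinite matrix, `vᵀBv = 0 ⇒ Bv = 0`;
* §2 ★★ `hess_quadForm_le_at_zero` — at a zero `p`, for every coordinate vector `u` (frame family `τ`, unit slot norms, trilinear third-derivative
  bound `K`): `|uᵀĤ(p)u| ≤ 2K·ℓ(u)³` whenever `p·exp(Σu_jτ_j)` is ALSO a zero (`ℓ = Σ|u_j|`; the second-order Taylor letter at `p`, where `F₀`
  and all its frame derivatives vanish);
* §3 ★★★ `hess_mulVec_eq_zero_of_valley_curve` — if `u : ℝ → ℝ^ι` has `p·exp(Σ u(s)_j τ_j)` a zero of `F₀` for all small `s ≠ 0` and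
  `s⁻¹·u(s) → v` as `s → 0`, then `Ĥ(p)v = 0`.  (The `6` comb tangents on `X_fix`, resp. the `3L³ − 1` gauge + `4` moduli tangents on `Ω_L`,
  are then kernel vectors; their construction and independence are NOT here.)

HONEST FRAMING: helper; ⟨24141⟩ stays OPEN; no stub / crux / rung / summit is closed; the Yang–Mills mass gap is NOT proved; no summit is proved
by a line.  THEOREMS ONLY (0 `def`, 0 `sorry`), standard axioms.  Explicit-unit seat `ym-line-fcl-p3` g40 (cell ym-idea-1, free hands),
`--supports stmt-QuantumFields-24141`.  References: [folklore].
-/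

set_option autoImplicit false

noncomputable section

open scoped Matrix BigOperators ContDiff Topology
open MeasureTheory Set Matrix Filter
open Literature.MathematicalPhysics.QuantumFieldTheory hiding SU2
open Literature.MathematicalPhysics.QuantumLattice
open Literature.MathematicalPhysics.QuantumFieldTheory.SUNBakryEmery (expSU coe_expSU matTop)

namespace Summit.QuantumFields.YangMills.Theorems.VirialFluxGap.FrameHessian

open Summit.QuantumFields.YangMills.Theorems.FemtoTransferGap
open Summit.QuantumFields.YangMills.Theorems.FemtoTransferGap.TT
open Summit.QuantumFields.YangMills.Theorems.VirialFluxGap.RingDeficit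
open Summit.QuantumFields.YangMills.Theorems.VirialFluxGap.FrameDerivative

/-! ## §1 Symmetric positive-semidefinite matrices: `vᵀBv = 0 ⇒ Bv = 0` -/

/-- For a symmetric matrix with nonnegative quadratic form, a null vector of the form is in the kernel. [folklore] -/
theorem quadForm_eq_zero_imp_mulVec_eq_zero {ι : Type*} [Fintype ι] {B : Matrix ι ι ℝ} (hB : Bᵀ = B)
    (hpsd : ∀ w, 0 ≤ w ⬝ᵥ (B *ᵥ w)) {v : ι → ℝ} (hv : v ⬝ᵥ (B *ᵥ v) = 0) : B *ᵥ v = 0 := by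
  -- `t ↦ (v + t w)ᵀB(v + t w) = 2t wᵀBv + t² wᵀBw ≥ 0` for all `t` forces `wᵀBv = 0`
  have hsym : ∀ w, w ⬝ᵥ (B *ᵥ v) = v ⬝ᵥ (B *ᵥ w) := fun w => by
    rw [dotProduct_mulVec, ← mulVec_transpose, hB, dotProduct_comm]
  have hw : ∀ w, w ⬝ᵥ (B *ᵥ v) = 0 := by
    intro w
    set a := w ⬝ᵥ (B *ᵥ v) with ha
    set c := w ⬝ᵥ (B *ᵥ w) with hc
    have hquad : ∀ t : ℝ, 0 ≤ 2 * t * a + t ^ 2 * c := by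
      intro t
      have h := hpsd (v + t • w)
      have e : (v + t • w) ⬝ᵥ (B *ᵥ (v + t • w)) = v ⬝ᵥ (B *ᵥ v) + 2 * t * a + t ^ 2 * c := by
        simp only [mulVec_add, mulVec_smul, add_dotProduct, dotProduct_add, smul_dotProduct, dotProduct_smul, smul_eq_mul, ← hsym w]
        ring
      rw [e, hv, zero_add] at h
      exact h
    have hc0 : 0 ≤ c := hpsd w
    -- take `t = −a/(c+1)`: `−2a²/(c+1) + a²c/(c+1)² ≥ 0` ⇒ `a²(c − 2(c+1)) ≥ 0` ⇒ `a = 0`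
    have h1 := hquad (-a / (c + 1))
    have hc1 : 0 < c + 1 := by linarith
    have key : 2 * (-a / (c + 1)) * a + (-a / (c + 1)) ^ 2 * c = -(a ^ 2 * (c + 2)) / (c + 1) ^ 2 := by
      field_simp
      ring
    rw [key] at h1
    have hnum : a ^ 2 * (c + 2) ≤ 0 := by
      have h2 : 0 < (c + 1) ^ 2 := by positivity
      have h3 : 0 ≤ -(a ^ 2 * (c + 2)) / (c + 1) ^ 2 * (c + 1) ^ 2 := mul_nonneg h1 h2.le
      rw [div_mul_cancel₀ _ h2.ne'] at h3
      linarith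
    nlinarith [sq_nonneg a]
  classical
  funext i
  have h := hw (Pi.single i 1)
  rwa [single_one_dotProduct] at h

/-! ## §2 The second-order Taylor letter between two zeros -/

variable {L : ℕ} [NeZero L]
variable {ι : Type*} [Fintype ι]

open scoped Matrix.Norms.Frobenius

attribute [local instance 2000] Literature.MathematicalPhysics.QuantumFieldTheory.SUNBakryEmery.matTop

/-- ★★ **The Hessian form between two zeros.**  At a zero `p` of `F₀`, if `p·exp(Σ u_jτ_j)` is also a zero (frame family with unit slot
norms, trilinear third-derivative bound `K`), then `|uᵀĤ(p)u| ≤ 2K·ℓ(u)³`, `ℓ(u) = Σ|u_j|`. [folklore] -/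
theorem hess_quadForm_le_at_zero {τ : ι → ((Fin (2 * L - 1 + 1) × Edge 3 L) ⊕ Site 3 L) → Matrix (Fin 2) (Fin 2) ℂ} (hτ : ∀ j w, (τ j w)ᴴ = -τ j w)
    (hτ0 : ∀ j w, (τ j w).trace = 0) (hτn : ∀ j w, ‖τ j w‖ ≤ 1) {p : ((Fin (2 * L - 1 + 1) → GaugeConfig 3 L SU2) × (Site 3 L → SU2))} (hp : ringDeficit L (fun _ => false) p = 0) {K : ℝ}
    (hK3 : ∀ (Y₁ Y₂ Y₃ : ((Fin (2 * L - 1 + 1) × Edge 3 L) ⊕ Site 3 L) → Matrix (Fin 2) (Fin 2) ℂ) (b₁ b₂ b₃ : ℝ), 0 ≤ b₁ → 0 ≤ b₂ → 0 ≤ b₃ →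
      (∀ w, ‖Y₁ w‖ ≤ b₁) → (∀ w, ‖Y₂ w‖ ≤ b₂) → (∀ w, ‖Y₃ w‖ ≤ b₃) → ∀ Q : ((Fin (2 * L - 1 + 1) → GaugeConfig 3 L SU2) × (Site 3 L → SU2)),
      |frameD Y₁ (frameD Y₂ (frameD Y₃ (ringPoly L))) (ringCoord L Q)| ≤ K * b₁ * b₂ * b₃)
    (u : ι → ℝ) (hu : ringDeficit L (fun _ => false) (p * multiCurve (dirOf τ u) (dirOf_conjTranspose hτ u) (dirOf_trace hτ0 u) 1) = 0) :
    |u ⬝ᵥ (frameHessRaw (L := L) τ (ringCoord L p) *ᵥ u)| ≤ 2 * K * (∑ j, |u j|) ^ 3 := by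
  set ℓ := ∑ j, |u j| with hℓ
  have hℓ0 : 0 ≤ ℓ := Finset.sum_nonneg fun j _ => abs_nonneg _
  have hYu : ∀ w, ‖dirOf τ u w‖ ≤ ℓ := by
    intro w
    rw [dirOf, Finset.sum_apply]
    refine (norm_sum_le _ _).trans (Finset.sum_le_sum fun j _ => ?_)
    rw [Pi.smul_apply, norm_smul, Real.norm_eq_abs]
    calc |u j| * ‖τ j w‖ ≤ |u j| * 1 := mul_le_mul_of_nonneg_left (hτn j w) (abs_nonneg _)
      _ = |u j| := mul_one _
  have hK : ∀ Q : ((Fin (2 * L - 1 + 1) → GaugeConfig 3 L SU2) × (Site 3 L → SU2)), |frameD (dirOf τ u) (frameD (dirOf τ u) (frameD (dirOf τ u) (ringPoly L))) (ringCoord L Q)| ≤ K * ℓ ^ 3 := by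
    intro Q
    have h := hK3 (dirOf τ u) (dirOf τ u) (dirOf τ u) ℓ ℓ ℓ hℓ0 hℓ0 hℓ0 hYu hYu hYu Q
    calc _ ≤ K * ℓ * ℓ * ℓ := h
      _ = K * ℓ ^ 3 := by ring
  have hT := frame_taylor2 (contDiff_ringPoly (L := L)) (dirOf τ u) (dirOf_conjTranspose hτ u) (dirOf_trace hτ0 u) p hK
  rw [← ringDeficit_eq_ringPoly, ← ringDeficit_eq_ringPoly, hu, hp,
    frameD_ringPoly_eq_zero_of_zero (dirOf τ u) (dirOf_conjTranspose hτ u) (dirOf_trace hτ0 u) hp, frameD_dirOf_frameD_dirOf] at hT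
  have e : (0 : ℝ) - 0 - 0 - 1 / 2 * (u ⬝ᵥ (frameHessRaw (L := L) τ (ringCoord L p) *ᵥ u)) =
      -(1 / 2) * (u ⬝ᵥ (frameHessRaw (L := L) τ (ringCoord L p) *ᵥ u)) := by ring
  rw [e, abs_mul, abs_neg, abs_of_pos (by norm_num : (0 : ℝ) < 1 / 2)] at hT
  linarith

/-! ## §3 Kernel vectors from valley curves -/

/-- ★★★ **Kernel vectors of the frame Hessian from curves in the zero set.**  At a zero `p` of `F₀`: if `u : ℝ → ℝ^ι` has
`p·exp(Σ u(s)_j τ_j)` a zero of `F₀` for all `s ≠ 0` near `0` and `s⁻¹·u(s) → v` as `s → 0` (`s ≠ 0`), then `Ĥ(p)v = 0`. [folklore] -/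
theorem hess_mulVec_eq_zero_of_valley_curve {τ : ι → ((Fin (2 * L - 1 + 1) × Edge 3 L) ⊕ Site 3 L) → Matrix (Fin 2) (Fin 2) ℂ} (hτ : ∀ j w, (τ j w)ᴴ = -τ j w)
    (hτ0 : ∀ j w, (τ j w).trace = 0) (hτn : ∀ j w, ‖τ j w‖ ≤ 1) {p : ((Fin (2 * L - 1 + 1) → GaugeConfig 3 L SU2) × (Site 3 L → SU2))} (hp : ringDeficit L (fun _ => false) p = 0) {K : ℝ}
    (hK3 : ∀ (Y₁ Y₂ Y₃ : ((Fin (2 * L - 1 + 1) × Edge 3 L) ⊕ Site 3 L) → Matrix (Fin 2) (Fin 2) ℂ) (b₁ b₂ b₃ : ℝ), 0 ≤ b₁ → 0 ≤ b₂ → 0 ≤ b₃ →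
      (∀ w, ‖Y₁ w‖ ≤ b₁) → (∀ w, ‖Y₂ w‖ ≤ b₂) → (∀ w, ‖Y₃ w‖ ≤ b₃) → ∀ Q : ((Fin (2 * L - 1 + 1) → GaugeConfig 3 L SU2) × (Site 3 L → SU2)),
      |frameD Y₁ (frameD Y₂ (frameD Y₃ (ringPoly L))) (ringCoord L Q)| ≤ K * b₁ * b₂ * b₃)
    (u : ℝ → ι → ℝ) (v : ι → ℝ)
    (hzero : ∀ᶠ s in 𝓝[≠] (0 : ℝ),
      ringDeficit L (fun _ => false) (p * multiCurve (dirOf τ (u s)) (dirOf_conjTranspose hτ (u s)) (dirOf_trace hτ0 (u s)) 1) = 0)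
    (hlim : Tendsto (fun s => s⁻¹ • u s) (𝓝[≠] (0 : ℝ)) (𝓝 v)) :
    frameHessRaw (L := L) τ (ringCoord L p) *ᵥ v = 0 := by
  set B := frameHessRaw (L := L) τ (ringCoord L p) with hB
  -- `B` is symmetric positive-semidefinite (zero of `F₀`)
  have hBt : Bᵀ = B := by
    ext j k
    rw [Matrix.transpose_apply, hB, frameHessRaw, frameHessRaw]
    exact (frameD_frameD_symm_of_zero (L := L) (hτ j) (hτ k) hp).symm
  have hpsd : ∀ w, 0 ≤ w ⬝ᵥ (B *ᵥ w) := by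
    intro w
    have h := hessian_nonneg_at_zero (dirOf τ w) (dirOf_conjTranspose hτ w) (dirOf_trace hτ0 w) hp
    rwa [frameD_dirOf_frameD_dirOf] at h
  -- the quadratic form along `w_s = s⁻¹ u(s)` is `O(s)` and tends to `vᵀBv`
  set q : (ι → ℝ) → ℝ := fun w => w ⬝ᵥ (B *ᵥ w) with hq
  have hqc : Continuous q := continuous_id.dotProduct (continuous_const.matrix_mulVec continuous_id)
  set ℓf : (ι → ℝ) → ℝ := fun w => ∑ j, |w j| with hℓf
  have hℓc : Continuous ℓf := continuous_finsetSum _ fun j _ => (continuous_apply j).abs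
  have hq_lim : Tendsto (fun s => q (s⁻¹ • u s)) (𝓝[≠] (0 : ℝ)) (𝓝 (q v)) := (hqc.tendsto v).comp hlim
  have hℓ_lim : Tendsto (fun s => ℓf (s⁻¹ • u s)) (𝓝[≠] (0 : ℝ)) (𝓝 (ℓf v)) := (hℓc.tendsto v).comp hlim
  -- the bound `|q(w_s)| ≤ 2K|s|·ℓ(w_s)³` eventually
  have hbound : ∀ᶠ s in 𝓝[≠] (0 : ℝ), |q (s⁻¹ • u s)| ≤ 2 * K * |s| * ℓf (s⁻¹ • u s) ^ 3 := by
    filter_upwards [hzero, self_mem_nhdsWithin] with s hs hs0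
    have hs0' : s ≠ 0 := hs0
    have h := hess_quadForm_le_at_zero hτ hτ0 hτn hp hK3 (u s) hs
    -- `u s = s • w_s`
    have hus : u s = s • (s⁻¹ • u s) := by rw [smul_smul, mul_inv_cancel₀ hs0', one_smul]
    have hqs : q (s⁻¹ • u s) = s⁻¹ ^ 2 * (u s ⬝ᵥ (B *ᵥ u s)) := by
      simp only [hq, mulVec_smul, smul_dotProduct, dotProduct_smul, smul_eq_mul]
      ring
    have hℓs : ∑ j, |u s j| = |s| * ℓf (s⁻¹ • u s) := by
      simp only [hℓf, Pi.smul_apply, smul_eq_mul, abs_mul, abs_inv, Finset.mul_sum]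
      refine Finset.sum_congr rfl fun j _ => ?_
      field_simp
    rw [hℓs, ← hB] at h
    rw [hqs, abs_mul]
    have habs : |s⁻¹ ^ 2| = (|s| ^ 2)⁻¹ := by rw [abs_pow, abs_inv, inv_pow]
    rw [habs]
    have hspos : 0 < |s| := abs_pos.2 hs0'
    rw [inv_mul_le_iff₀ (by positivity)]
    calc |u s ⬝ᵥ (B *ᵥ u s)| ≤ 2 * K * (|s| * ℓf (s⁻¹ • u s)) ^ 3 := h
      _ = |s| ^ 2 * (2 * K * |s| * ℓf (s⁻¹ • u s) ^ 3) := by ring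
  -- the right-hand side tends to `0`
  have hrhs : Tendsto (fun s : ℝ => 2 * K * |s| * ℓf (s⁻¹ • u s) ^ 3) (𝓝[≠] (0 : ℝ)) (𝓝 0) := by
    have h1 : Tendsto (fun s : ℝ => 2 * K * |s|) (𝓝[≠] (0 : ℝ)) (𝓝 0) := by
      have : Tendsto (fun s : ℝ => 2 * K * |s|) (𝓝 (0 : ℝ)) (𝓝 (2 * K * |0|)) :=
        ((continuous_const.mul continuous_abs).tendsto 0)
      rw [abs_zero, mul_zero] at this
      exact this.mono_left nhdsWithin_le_nhds
    have h2 : Tendsto (fun s : ℝ => ℓf (s⁻¹ • u s) ^ 3) (𝓝[≠] (0 : ℝ)) (𝓝 (ℓf v ^ 3)) := hℓ_lim.pow 3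
    have := h1.mul h2
    rw [zero_mul] at this
    exact this
  -- squeeze: `q(w_s) → q v` and `|q(w_s)| ≤ rhs → 0`, so `q v = 0`
  have hq0 : q v = 0 := by
    have habs_lim : Tendsto (fun s => |q (s⁻¹ • u s)|) (𝓝[≠] (0 : ℝ)) (𝓝 |q v|) := hq_lim.abs
    have hle : |q v| ≤ 0 := by
      refine le_of_tendsto_of_tendsto habs_lim hrhs hbound
    exact abs_eq_zero.1 (le_antisymm hle (abs_nonneg _))
  exact quadForm_eq_zero_imp_mulVec_eq_zero hBt hpsd hq0

end Summit.QuantumFields.YangMills.Theorems.VirialFluxGap.FrameHessian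

end
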